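import Summits.Ventures.PercRepro.S2ElevenSevenK2SpreadA
import Summits.Ventures.PercRepro.S2FourteenSevenSpreadNine

/-!
# PercRepro — S2: THE TWICE-SCALED CELL `(11, 7)` OF `(13, 7)` AT `K₂ = 12107` — THE SPREAD ROWS `t ≥ 9` AND THE SPREAD CASE (p7, gen 17)

On the twice-scaled cell `(11, 7)` (rank `11` on `18` points, coloops allowed, the standard caps `11 / 69 / 401`) at `t ≥ 9`
triangles (`t ≤ 11`), `≥ 2` triangles avoid any given triangle and the per-triangle top-`6` charge is `≤ 345` — the `(14, 7)` row
`t = 9` machinery at `18` points (three avoiding triangles: `C(9, 2)·6 + C(9, 3) = 300`; two sharing a point: `C(15, 3) − C(10, 3) = 335`;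
two disjoint and a `4`-circuit outside: `C(10, 2)·5 + C(10, 3) = 345`; inside: `155`); with the four-triangle count `U₅ ≤ 7728`:
`U ≤ 30423` against `30551` (`m = 378`, `0.996`). **`c025_eleven_seven_k2_spread_ge_nine`**, and with `S2ElevenSevenK2SpreadA` THE
SPREAD CASE OF THE TWICE-SCALED CELL, UNCONDITIONAL: **`c025_eleven_seven_k2_spread`**. Nothing about any cell is claimed. Axioms: standard.
-/

open scoped Matroid

namespace PercRepro

namespace ThmN

open Set

variable {α : Type}

/-- **The rows `t ≥ 9` of the spread case of the twice-scaled cell `(11, 7)` at `K₂`** (charge `≤ 345` per triangle). -/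
theorem c025_eleven_seven_k2_spread_ge_nine (M : Matroid α) [M.Finite]
    (hR : M.eRank = ((11 : ℕ) : ℕ∞)) (hn : M.E.ncard = 11 + 7)
    (hfree : ∀ e ∈ M.E, ∃ A ⊆ M.E \ {e}, e ∉ M.closure A ∧ e ∉ M.closure ((M.E \ {e}) \ A))
    (h4 : ¬ ∃ W ⊆ M.E, W.ncard ≤ 9 ∧ W.encard = M.eRk W + 4)
    (ht9 : 9 ≤ {C : Set α | M.IsCircuit C ∧ C.ncard = 3}.ncard) :
    ((phiK 13 5 - 6) / 4) * (Matroid.topCount M 11 5 : ℚ) ≤ (Matroid.midCount M 11 5 : ℚ) := by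
  classical
  have hd : M.E.encard = M.eRank + ((7 : ℕ) : ℕ∞) := by
    rw [hR, ← M.ground_finite.cast_ncard_eq, hn]
    push_cast
    ring
  obtain ⟨hs3, hs4c, hs5c⟩ := caps_eleven_seven M hd hfree
  have hflat : ∀ X ⊆ M.E, M.eRk X ≤ 5 → X.ncard ≤ 8 := fun X hX hr => by
    have := S2.ncard_le_of_eRk_le_of_not_nullity M 4 9 (by norm_num) h4 hX (r := 5) (by norm_num) (by exact_mod_cast hr)
    omega
  have hflat' : ∀ X ⊆ M.E, M.eRk X ≤ 4 → X.ncard ≤ 7 := fun X hX hr => by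
    have := S2.ncard_le_of_eRk_le_of_not_nullity M 4 9 (by norm_num) h4 hX (r := 4) (by norm_num) (by exact_mod_cast hr)
    omega
  have hL0 : ∀ e ∈ M.E, ¬ M.IsLoop e := not_isLoop_of_free M hfree
  have hs : ∀ e ∈ M.E, ∀ f ∈ M.E, e ≠ f → M.eRk {e, f} = 2 := by
    intro e he f hf hef
    have h2 : (2 : ℕ∞) ≤ M.eRk {e, f} :=
      two_le_eRk_of_two_le_ncard_of_free M hfree (pair_subset he hf) (by rw [ncard_pair hef])
    have h3 : M.eRk {e, f} ≤ 2 := by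
      have := M.eRk_le_encard {e, f}
      rwa [encard_pair hef] at this
    exact le_antisymm h3 h2
  have hC1 : ∀ L ⊆ M.E, M.eRk L = 2 → L.ncard ≤ 3 :=
    fun L hL hr => ncard_le_three_of_eRk_two M hs hfree hL hr
  have hcirc : ∀ C, M.IsCircuit C → 3 ≤ C.encard := three_le_encard_of_circuit M hL0 hs
  have hTfin : {C : Set α | M.IsCircuit C ∧ C.ncard = 3}.Finite :=
    M.ground_finite.finite_subsets.subset (fun C hC => hC.1.subset_ground)
  have h9 : ∀ X ⊆ M.E, X.ncard ≤ 9 → X.encard ≤ M.eRk X + 3 := by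
    intro X hX hX9
    by_contra hlt
    push Not at hlt
    have hk : M.eRk X + 4 ≤ X.encard := by
      have := Order.add_one_le_of_lt hlt
      rwa [add_assoc, show (3 : ℕ∞) + 1 = 4 by norm_num] at this
    obtain ⟨W', hW'X, hW'⟩ := S2.exists_subset_encard_eq_eRk_add M hX 4 hk
    exact h4 ⟨W', hW'X.trans hX, (Set.ncard_le_ncard hW'X (M.ground_finite.subset hX)).trans hX9, hW'⟩
  have hs6 : {C : Set α | M.IsCircuit C ∧ C.ncard = 6}.ncard ≤ (7 + 5).choose 6 :=
    Matroid.ncard_circuits_le_choose_of_encard M hd 5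
  norm_num [Nat.choose] at hs6
  have cellA : ∀ (U S m : ℕ) (A : ℚ), Matroid.topCount M 11 5 ≤ U →
      {X : Set α | X ⊆ M.E ∧ M.eRk X = M.eRank}.ncard ≤ S → m ≤ 1024 →
      1024 * (U : ℚ) ≤ ((1024 - m : ℕ) : ℚ) * 2 ^ (7 - 5) * (12107 : ℚ) →
      (1024 : ℚ) * (A + (S : ℚ)) ≤ (m : ℚ) * 2 ^ 18 →
      ({X : Set α | X ⊆ M.E ∧ M.eRk X ≤ 5}.ncard : ℚ) ≤ A →
      ((phiK 13 5 - 6) / 4) * (Matroid.topCount M 11 5 : ℚ) ≤ (Matroid.midCount M 11 5 : ℚ) := by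
    intro U S m A hU hS hm hpoly htail hA
    exact c025_core_five_cell_of_counts_xqictq5g M 11 7 (by norm_num) hR hn U hU _ hA S hS
      12107 (by norm_num) ((phiK 13 5 - 6) / 4) (by rw [phiK_thirteen_five]; norm_num) ⟨m, hm, hpoly, htail⟩
  -- the top count through the top `5`- and `6`-sets
  have hUsum := S2.topCount_mul_five_le_seven M hR hd hC1 hflat
  -- the per-triangle charge at `t ≥ 9`: `≤ 345` in every configuration of the avoiding circuits
  have hc345 : ∀ T : Set α, M.IsCircuit T → T.ncard = 3 →
      {B : Set α | B ⊆ M.E ∧ B.ncard = 6 ∧ T ⊆ B ∧ M.eRk (M.E \ B) = M.eRank}.ncard ≤ 345 := by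
    intro T hT hT3
    have hTfin' : T.Finite := M.ground_finite.subset hT.subset_ground
    have h7 := S2.ncard_triangles_le_seven_add_disjoint M hC1 h9 hT hT3
    have h𝒟fin : {C : Set α | M.IsCircuit C ∧ C.ncard = 3 ∧ Disjoint C T}.Finite :=
      hTfin.subset (fun C hC => ⟨hC.1, hC.2.1⟩)
    have hZ : (M.E \ T).ncard = 15 := by
      rw [Set.ncard_sdiff hT.subset_ground hTfin', hn, hT3]
    -- the lever on an avoiding set of nullity `≥ 3` and `≤ u` points
    have lever : ∀ (P : Set α) (u : ℕ), P ⊆ M.E \ T → M.eRk P + 3 ≤ P.encard → P.ncard ≤ u → u ≤ 10 →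
        {B : Set α | B ⊆ M.E ∧ B.ncard = 6 ∧ T ⊆ B ∧ M.eRk (M.E \ B) = M.eRank}.ncard ≤
          u.choose 2 * (15 - u) + u.choose 3 := by
      intro P u hP hP3 hPu hu10
      have h := S2.ncard_top_six_through_le_of_nullity_three M hR hn hT.subset_ground hT3 hP hP3
      rw [hZ] at h
      refine h.trans ?_
      generalize P.ncard = v at hPu
      interval_cases u <;> interval_cases v <;> norm_num [Nat.choose]
    by_cases h3 : 3 ≤ {C : Set α | M.IsCircuit C ∧ C.ncard = 3 ∧ Disjoint C T}.ncard
    · -- (a) three avoiding triangles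
      obtain ⟨D₁, D₂, D₃, hD₁, hD₂, hD₃, h12, h13, h23⟩ := (Set.two_lt_ncard_iff h𝒟fin).1 (by omega)
      have hP3 := S2.eRk_union_three_triangles_add_three_le M hC1 hD₁.1 hD₁.2.1 hD₂.1 hD₂.2.1 hD₃.1 hD₃.2.1 h12 h13 h23
      have hP : D₁ ∪ D₂ ∪ D₃ ⊆ M.E \ T := by
        refine Set.union_subset (Set.union_subset ?_ ?_) ?_
        · exact Set.subset_sdiff.2 ⟨hD₁.1.subset_ground, hD₁.2.2⟩
        · exact Set.subset_sdiff.2 ⟨hD₂.1.subset_ground, hD₂.2.2⟩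
        · exact Set.subset_sdiff.2 ⟨hD₃.1.subset_ground, hD₃.2.2⟩
      have hu : (D₁ ∪ D₂ ∪ D₃).ncard ≤ 9 := by
        have h1 := Set.ncard_union_le (D₁ ∪ D₂) D₃
        have h2 := Set.ncard_union_le D₁ D₂
        have h3 := hD₁.2.1
        have h4 := hD₂.2.1
        have h5 := hD₃.2.1
        omega
      exact (lever _ 9 hP hP3 hu (by norm_num)).trans (by norm_num [Nat.choose])
    push Not at h3
    -- two avoiding triangles and a `4`-circuit avoiding `T`
    obtain ⟨D₁, D₂, hD₁, hD₂, h12⟩ := (Set.one_lt_ncard_iff h𝒟fin).1 (by omega)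
    obtain ⟨Q, hQ, hQ4, hQT⟩ := S2.exists_four_circuit_disjoint_of_six_le M hC1 hs h9 hT hT3 (by omega)
    have hD₁E : D₁ ⊆ M.E \ T := Set.subset_sdiff.2 ⟨hD₁.1.subset_ground, hD₁.2.2⟩
    have hD₂E : D₂ ⊆ M.E \ T := Set.subset_sdiff.2 ⟨hD₂.1.subset_ground, hD₂.2.2⟩
    have hQE : Q ⊆ M.E \ T := Set.subset_sdiff.2 ⟨hQ.subset_ground, hQT⟩
    have hD₁fin : D₁.Finite := M.ground_finite.subset hD₁.1.subset_ground
    have hD₂fin : D₂.Finite := M.ground_finite.subset hD₂.1.subset_ground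
    have hU6 : (D₁ ∪ D₂).ncard ≤ 6 := by
      have := Set.ncard_union_le D₁ D₂
      have h3 := hD₁.2.1
      have h4 := hD₂.2.1
      omega
    by_cases hU5 : (D₁ ∪ D₂).ncard ≤ 5
    · -- (b) the two triangles share a point: the plain hitting lever
      have h := S2.ncard_top_six_through_add_le M hR hn hT.subset_ground hT3 hD₁.1 hD₂.1 h12 hD₁.2.2 hD₂.2.2
      have hk : 10 ≤ ((M.E \ T) \ (D₁ ∪ D₂)).ncard := by
        rw [Set.ncard_sdiff (Set.union_subset hD₁E hD₂E) (hD₁fin.union hD₂fin), hZ]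
        omega
      have hch : (10 : ℕ).choose 3 ≤ ((M.E \ T) \ (D₁ ∪ D₂)).ncard.choose 3 := Nat.choose_le_choose 3 hk
      rw [hZ] at h
      norm_num [Nat.choose] at h hch
      omega
    push Not at hU5
    have hU6' : (D₁ ∪ D₂).ncard = 6 := by omega
    by_cases hQsub : Q ⊆ D₁ ∪ D₂
    · -- (d) `Q` inside the two disjoint triangles: `D₁ ∪ D₂ ⊆ cl Q`, rank `3`, nullity `3`
      have hdisj : Disjoint D₁ D₂ := by
        rw [Set.disjoint_iff_inter_eq_empty, ← Set.ncard_eq_zero (hD₁fin.subset Set.inter_subset_left)]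
        have := Set.ncard_union_add_ncard_inter D₁ D₂ hD₁fin hD₂fin
        have h3 := hD₁.2.1
        have h4 := hD₂.2.1
        omega
      have hQfin : Q.Finite := M.ground_finite.subset hQ.subset_ground
      -- `Q` meets each `Dᵢ` in exactly two points
      have hsplit : (Q ∩ D₁).ncard + (Q ∩ D₂).ncard = 4 := by
        rw [← hQ4, ← Set.ncard_union_eq (hdisj.mono Set.inter_subset_right Set.inter_subset_right)
          (hQfin.subset Set.inter_subset_left) (hQfin.subset Set.inter_subset_left), ← Set.inter_union_distrib_left,
          Set.inter_eq_left.2 hQsub]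
      have hnot : ∀ {D : Set α}, M.IsCircuit D → D.ncard = 3 → (Q ∩ D).ncard ≤ 2 := by
        intro D hD hD3
        by_contra hlt
        push Not at hlt
        have hDfin : D.Finite := M.ground_finite.subset hD.subset_ground
        have hle : D.ncard ≤ (Q ∩ D).ncard := by omega
        have heq : Q ∩ D = D := Set.eq_of_subset_of_ncard_le Set.inter_subset_right hle hDfin
        have hDQ : D ⊆ Q := by rw [← heq]; exact Set.inter_subset_left
        have := hD.eq_of_subset_isCircuit hQ hDQ
        rw [this, hQ4] at hD3
        omega
      have hcl : ∀ {D : Set α}, M.IsCircuit D → D.ncard = 3 → (Q ∩ D).ncard = 2 → D ⊆ M.closure Q := by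
        intro D hD hD3 h2
        obtain ⟨a, b, hab, hQD⟩ := Set.ncard_eq_two.1 h2
        have haQ : a ∈ Q ∩ D := by rw [hQD]; exact Set.mem_insert a {b}
        have hbQ : b ∈ Q ∩ D := by rw [hQD]; exact Set.mem_insert_of_mem a (Set.mem_singleton b)
        have hsub := S2.subset_closure_pair_of_dep_three M hs hD.subset_ground hD3 hD.dep haQ.2 hbQ.2 hab
        refine hsub.trans (M.closure_subset_closure ?_)
        exact Set.insert_subset haQ.1 (Set.singleton_subset_iff.2 hbQ.1)
      have h1 := hnot hD₁.1 hD₁.2.1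
      have h2 := hnot hD₂.1 hD₂.2.1
      have hP3 : M.eRk (D₁ ∪ D₂) + 3 ≤ (D₁ ∪ D₂).encard := by
        have hsubcl : D₁ ∪ D₂ ⊆ M.closure Q :=
          Set.union_subset (hcl hD₁.1 hD₁.2.1 (by omega)) (hcl hD₂.1 hD₂.2.1 (by omega))
        have hrk : M.eRk (D₁ ∪ D₂) ≤ 3 := by
          have hQr := hQ.eRk_add_one_eq
          rw [← hQfin.cast_ncard_eq, hQ4] at hQr
          have hQr' : M.eRk Q ≤ 3 := by
            have : M.eRk Q + 1 ≤ 3 + 1 := by rw [hQr]; norm_num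
            exact (ENat.add_le_add_iff_right (by simp)).1 this
          calc M.eRk (D₁ ∪ D₂) ≤ M.eRk (M.closure Q) := M.eRk_mono hsubcl
            _ = M.eRk Q := M.eRk_closure_eq Q
            _ ≤ 3 := hQr'
        rw [← (hD₁fin.union hD₂fin).cast_ncard_eq, hU6']
        calc M.eRk (D₁ ∪ D₂) + 3 ≤ 3 + 3 := by gcongr
          _ = ((6 : ℕ) : ℕ∞) := by norm_num
      exact (lever _ 6 (Set.union_subset hD₁E hD₂E) hP3 hU6'.le (by norm_num)).trans (by norm_num [Nat.choose])
    · -- (c) `Q` not inside `D₁ ∪ D₂`: the three circuits have a union of nullity `≥ 3` on `≤ 10` points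
      have hP3 := S2.eRk_union_three_add_three_le_encard M hD₁.1 hD₂.1 hQ h12 hQsub
      have hu : (D₁ ∪ D₂ ∪ Q).ncard ≤ 10 := by
        have := Set.ncard_union_le (D₁ ∪ D₂) Q
        omega
      exact (lever _ 10 (Set.union_subset (Set.union_subset hD₁E hD₂E) hQE) hP3 hu le_rfl).trans
        (by norm_num [Nat.choose])
  -- the top `6`-sets by their smallest circuit, charge `345`, at `t ≤ 11`
  have htop6 : {B : Set α | B ⊆ M.E ∧ B.ncard = 6 ∧ M.eRk B = 5 ∧ M.eRk (M.E \ B) = M.eRank}.ncard ≤ 16211 := by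
    have := S2.ncard_top_six_le_n M hn hcirc 345 hc345
    norm_num [Nat.choose] at this
    have h3' := Nat.mul_le_mul_right 345 hs3
    have h5' := Nat.mul_le_mul_right 13 hs5c
    have h4' := Nat.mul_le_mul_right 91 hs4c
    omega
  -- the tail at `t ≤ 11` with the caps `(64, 401)`
  have hA := ncard_eRk_le_five_le_spread M 11 7 (by norm_num) hR hn hfree hflat hflat' 11 69 401 hs3 hs4c hs5c
  -- four triangles: the top `5`-sets and the spanning sets
  obtain ⟨T₁, T₂, T₃, T₄, hT₁, hT₂, hT₃, hT₄, h12, h13, h14, h23, h24, h34⟩ :=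
    (Set.three_lt_ncard_iff hTfin).1 (by omega)
  have hS' : {X : Set α | X ⊆ M.E ∧ M.eRk X = M.eRank}.ncard ≤ 48847 := by
    have hS := S2.ncard_spanning_add_le_of_three_triangles M hR hn (by norm_num) hC1 hT₁.1 hT₁.2 hT₂.1 hT₂.2
      hT₃.1 hT₃.2 h12 h13 h23
    norm_num [Finset.sum_range_succ, Nat.choose] at hS
    omega
  have htop5 := S2.ncard_top_five_le_of_four_triangles_eighteen M hR hn hC1 hT₁ hT₂ hT₃ hT₄ h12 h13 h14 h23 h24 h34
  have hU' : Matroid.topCount M 11 5 ≤ 30423 := by omega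
  exact cellA _ 48847 378 _ hU' hS' (by norm_num) (by norm_num) (by norm_num [Nat.choose]) hA


/-- **The spread case of the twice-scaled cell `(11, 7)` at `K₂`, unconditional.** -/
theorem c025_eleven_seven_k2_spread (M : Matroid α) [M.Finite]
    (hR : M.eRank = ((11 : ℕ) : ℕ∞)) (hn : M.E.ncard = 11 + 7)
    (hfree : ∀ e ∈ M.E, ∃ A ⊆ M.E \ {e}, e ∉ M.closure A ∧ e ∉ M.closure ((M.E \ {e}) \ A))
    (h4 : ¬ ∃ W ⊆ M.E, W.ncard ≤ 9 ∧ W.encard = M.eRk W + 4) :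
    ((phiK 13 5 - 6) / 4) * (Matroid.topCount M 11 5 : ℚ) ≤ (Matroid.midCount M 11 5 : ℚ) := by
  by_cases ht2 : {C : Set α | M.IsCircuit C ∧ C.ncard = 3}.ncard ≤ 2
  · exact c025_eleven_seven_k2_spread_le_two M hR hn hfree h4 ht2
  by_cases ht8 : {C : Set α | M.IsCircuit C ∧ C.ncard = 3}.ncard ≤ 8
  · exact c025_eleven_seven_k2_spread_three_to_eight M hR hn hfree h4 (by omega) ht8
  · exact c025_eleven_seven_k2_spread_ge_nine M hR hn hfree h4 (by omega)

end ThmN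

end PercRepro
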